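import Summits.NavierStokesRegularity.NavierStokesRegularity.Theorems.LerayQuarterDissipationFiniteDissipationLiouvilleCriticalPoint
import Summits.NavierStokesRegularity.NavierStokesRegularity.Theorems.LerayQuarterDissipationFiniteDissipationLiouvilleFarField
import HarnessLib

/-!
# Crux `FiniteDissipationLiouville` (stmt-NavierStokesRegularity-22144): the critical element is
# bounded off the space-time apex

Theorems file of route `LerayQuarterDissipation` (seat ns-lqd-p2 g7; `--supports` the crux).
Navier–Stokes regularity is NOT proved by anything here; no summit is.

`CriticalPoint.not_singular_translate_of_minimal` (p609602): a singular member `W` of `𝒟_{C,K_c}`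
with `K_c` minimal is regular at every final-time point `x₁ ≠ 0`. Combined with the lead's far-field
regularity through the singular time (`Birth.Apex.exists_bound_off_singularSet`, p602950: every member of
the stratum is bounded near `t = 0` off any `δ`-neighbourhood of its final-time singular points,
uniformly out to spatial infinity), this gives the portrait statement:

* `criticalElement_bounded_off_apex` — **a minimal singular member is bounded on
  `(−ρ², 0) × {‖x‖ ≥ δ}` for every `δ > 0`** (some `ρ = ρ(δ) > 0`, bound `M(δ)`): the whole
  singularity of the critical element sits at the single space-time point `(0, 0)`;
* `exists_criticalElement_onePointProfile` — packaged with `CriticalElement.exists_minimal_singular`: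
  if the crux fails for `C` at level `K`, there is a critical singular member of some `𝒟_{C,K_c}`,
  `K_c ≤ K`, which is bounded away from the apex in the above sense.

References: Koch–Nadirashvili–Seregin–Šverák 2009, §4; Kenig–Merle 2006 (critical elements).
-/

noncomputable section

-- the summit and its single sub-problem share the name (CONVENTIONS §1), as in every Theorems file
set_option linter.dupNamespace false

namespace Summit.NavierStokesRegularity.NavierStokesRegularity.Theorems.FiniteDissipationLiouville.CriticalPoint

open MeasureTheory Set Filter Topology Metric Function
open Literature.Analysis Literature.Analysis.FluidPDE
open Summit.NavierStokesRegularity.NavierStokesRegularity.Theorems.FiniteDissipationLiouville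
open scoped ENNReal NNReal

/-- **The critical element is bounded off the space-time apex.** Let `W ∈ 𝒟_{C,K_c}` be singular
at the apex with `K_c` minimal (no `𝒟_{C,K'}`, `K' < K_c`, has a singular member). Then for every
`δ > 0` there are `ρ > 0` and `M` with `‖W(t, x)‖ ≤ M` for all `t ∈ (−ρ², 0)` and all `‖x‖ ≥ δ`
(`not_singular_translate_of_minimal`: no final-time singular point other than `0`;
`Birth.Apex.exists_bound_off_singularSet`: boundedness off the singular points, out to infinity). [cite: KochNadirashviliSereginSverak2009, §4 (arXiv:0709.3599 p. 8)] -/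
theorem criticalElement_bounded_off_apex {C Kc : ℝ}
    {W : ℝ → EuclideanSpace ℝ (Fin 3) → EuclideanSpace ℝ (Fin 3)} (hW : IsTypeIAncientMild C W)
    (hlaw : ∀ s : ℝ, s < 0 → ∫⁻ x, ‖fderiv ℝ (W s) x‖ₑ ^ 2 ≤ ENNReal.ofReal (Kc / Real.sqrt (-s)))
    (hsing : ∀ r > 0, ∀ M : ℝ, ∃ t ∈ Ioo (-(r ^ 2)) (0 : ℝ),
      ∃ x ∈ ball (0 : EuclideanSpace ℝ (Fin 3)) r, M < ‖W t x‖)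
    (hmin : ∀ K' : ℝ, K' < Kc → ∀ w : ℝ → EuclideanSpace ℝ (Fin 3) → EuclideanSpace ℝ (Fin 3),
      IsTypeIAncientMild C w →
      (∀ s : ℝ, s < 0 → ∫⁻ x, ‖fderiv ℝ (w s) x‖ₑ ^ 2 ≤ ENNReal.ofReal (K' / Real.sqrt (-s))) →
      ¬ (∀ r > 0, ∀ M : ℝ, ∃ t ∈ Ioo (-(r ^ 2)) (0 : ℝ),
        ∃ x ∈ ball (0 : EuclideanSpace ℝ (Fin 3)) r, M < ‖w t x‖))
    {δ : ℝ} (hδ : 0 < δ) :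
    ∃ ρ M : ℝ, 0 < ρ ∧ ∀ t ∈ Ioo (-(ρ ^ 2)) (0 : ℝ), ∀ x : EuclideanSpace ℝ (Fin 3),
      δ ≤ ‖x‖ → ‖W t x‖ ≤ M := by
  obtain ⟨ρ, M, hρ, hbd⟩ := Birth.Apex.exists_bound_off_singularSet hW hlaw hδ
  refine ⟨ρ, M, hρ, fun t ht x hx => hbd t ht x fun s hs => ?_⟩
  -- every final-time singular point is the origin
  by_cases hs0 : s = 0
  · rw [hs0, dist_zero_right]; exact hx
  · exfalso
    refine not_singular_translate_of_minimal hW hlaw hsing hmin hs0 ?_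
    intro r hr M'
    obtain ⟨t', ht', y, hy, hM'⟩ := hs r hr M'
    refine ⟨t', ht', y - s, ?_, ?_⟩
    · rw [mem_ball_zero_iff, ← dist_eq_norm]; exact hy
    · rwa [add_sub_cancel]

/-- **If the crux fails, a one-point blow-up profile exists.** If some `𝒟_{C,K}` has a member
singular at the apex then there are `K_c ≤ K` and a singular member `W ∈ 𝒟_{C,K_c}` with `K_c`
minimal which, for every `δ > 0`, is bounded on `(−ρ², 0) × {‖x‖ ≥ δ}` for some `ρ > 0`
(`CriticalElement.exists_minimal_singular` + `criticalElement_bounded_off_apex`). [cite: KochNadirashviliSereginSverak2009, §4 (arXiv:0709.3599 p. 8)] -/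
theorem exists_criticalElement_onePointProfile {C K : ℝ}
    {u : ℝ → EuclideanSpace ℝ (Fin 3) → EuclideanSpace ℝ (Fin 3)} (hu : IsTypeIAncientMild C u)
    (hlaw : ∀ s : ℝ, s < 0 → ∫⁻ x, ‖fderiv ℝ (u s) x‖ₑ ^ 2 ≤ ENNReal.ofReal (K / Real.sqrt (-s)))
    (hsing : ∀ r > 0, ∀ M : ℝ, ∃ t ∈ Ioo (-(r ^ 2)) (0 : ℝ),
      ∃ x ∈ ball (0 : EuclideanSpace ℝ (Fin 3)) r, M < ‖u t x‖) :
    ∃ Kc : ℝ, Kc ≤ K ∧ ∃ W : ℝ → EuclideanSpace ℝ (Fin 3) → EuclideanSpace ℝ (Fin 3),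
      IsTypeIAncientMild C W ∧
      (∀ s : ℝ, s < 0 → ∫⁻ x, ‖fderiv ℝ (W s) x‖ₑ ^ 2 ≤ ENNReal.ofReal (Kc / Real.sqrt (-s))) ∧
      (∀ r > 0, ∀ M : ℝ, ∃ t ∈ Ioo (-(r ^ 2)) (0 : ℝ),
        ∃ x ∈ ball (0 : EuclideanSpace ℝ (Fin 3)) r, M < ‖W t x‖) ∧
      (∀ K' : ℝ, K' < Kc → ∀ w : ℝ → EuclideanSpace ℝ (Fin 3) → EuclideanSpace ℝ (Fin 3),
        IsTypeIAncientMild C w →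
        (∀ s : ℝ, s < 0 → ∫⁻ x, ‖fderiv ℝ (w s) x‖ₑ ^ 2 ≤ ENNReal.ofReal (K' / Real.sqrt (-s))) →
        ¬ (∀ r > 0, ∀ M : ℝ, ∃ t ∈ Ioo (-(r ^ 2)) (0 : ℝ),
          ∃ x ∈ ball (0 : EuclideanSpace ℝ (Fin 3)) r, M < ‖w t x‖)) ∧
      ∀ δ > 0, ∃ ρ M : ℝ, 0 < ρ ∧ ∀ t ∈ Ioo (-(ρ ^ 2)) (0 : ℝ), ∀ x : EuclideanSpace ℝ (Fin 3),
        δ ≤ ‖x‖ → ‖W t x‖ ≤ M := by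
  obtain ⟨Kc, hKc, ⟨W, hW, hWlaw, hWsing⟩, hmin⟩ := CriticalElement.exists_minimal_singular hu hlaw hsing
  exact ⟨Kc, hKc, W, hW, hWlaw, hWsing, hmin, fun δ hδ =>
    criticalElement_bounded_off_apex hW hWlaw hWsing hmin hδ⟩

end Summit.NavierStokesRegularity.NavierStokesRegularity.Theorems.FiniteDissipationLiouville.CriticalPoint

end
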